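import Summits.AtomisticToContinuum.FouriersLaw.Theorems.BondHeatUncertaintyLinearResponseFTURPredictableShift
import Summits.AtomisticToContinuum.FouriersLaw.Theorems.BondHeatUncertaintyLinearResponseFTURGridIncrements
import Summits.AtomisticToContinuum.FouriersLaw.Theorems.BondHeatUncertaintyLinearResponseFTURSchemeNodes
import Mathlib.MeasureTheory.Measure.Haar.Unique

/-!
# The discrete Cameron–Martin identity between the damped and anti-damped schemes (K3 helper)

Helper file for stub `stub_antiDampedGirsanov` (K3) of line `lebesgue-flip-duality`, crux ★
`BondHeatUncertainty.LinearResponseFTUR` (stmt-AtomisticToContinuum-9122).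

The damped scheme driven by the increments `S x` is the anti-damped scheme driven by `x`, where
`(S x)_k = -x_k + 2γh (clamp_R(p_0(z^a_k))/c_L, clamp_R(p_{N-1}(z^a_k))/c_R)` is a PREDICTABLE affine
shift (`…Scheme.lean`). On the finite increment space `Fin M → ℝ × ℝ` (Gaussian law
`vol.withDensity (piGaussDensity M h)` = the law of the grid increments of the Brownian pair,
`…GridIncrements.lean`) `S` preserves Lebesgue measure (`…PredictableShift.lean`), whence the exact
reweighting identity

  `E[Ψ(ξ)] = E[Ψ(S ξ) · exp Σ_k Σ_b (2γ ĉ_{b,k} ξ_{b,k}/c_b - 2γ²h ĉ²_{b,k}/c_b²)]`,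
  `ĉ_{b,k} = clamp_R(p_b(z^a_k(ξ)))`, `ξ` the grid increments (`lintegral_eq_lintegral_shiftFin_mul`),

and symmetrically with the inverse shift `U` (predictable with respect to the DAMPED states,
`lintegral_eq_lintegral_unshiftFin_mul`). Together with `path_shiftFin` / `path_unshiftFin` (the scheme
paths under `S` / `U`) these are the discrete forms (DI-1)/(DI-2) of the anti-damped Girsanov formula.
-/

noncomputable section

namespace Summit.AtomisticToContinuum.FouriersLaw.Theorems.LinearResponseFTUR

open MeasureTheory ProbabilityTheory Filter Set Function Finset Topology
open scoped NNReal ENNReal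
open Literature.MathematicalPhysics.KineticTheory
open Literature.MathematicalPhysics.KineticTheory.HeatConduction
open Literature.Probability.Process
open Literature.Analysis.ODE

variable {N : ℕ}

/-! ### Finite increment vectors -/

/-- Read a finite increment vector as an infinite one (zero beyond `M`). -/
def extIncr (M : ℕ) (x : Fin M → ℝ × ℝ) : ℕ → ℝ × ℝ := fun j => if h : j < M then x ⟨j, h⟩ else 0

/-- Inside the range, `extIncr` reads the vector. -/
theorem extIncr_apply_lt {M : ℕ} (x : Fin M → ℝ × ℝ) {j : ℕ} (hj : j < M) : extIncr M x j = x ⟨j, hj⟩ :=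
  dif_pos hj

/-- On a `Fin M` index, `extIncr` reads the vector. -/
@[simp] theorem extIncr_apply_fin {M : ℕ} (x : Fin M → ℝ × ℝ) (k : Fin M) : extIncr M x k = x k := by
  rw [extIncr_apply_lt x k.2]

/-- Each coordinate of `extIncr` is measurable. -/
theorem measurable_extIncr_apply (M j : ℕ) : Measurable fun x : Fin M → ℝ × ℝ => extIncr M x j := by
  unfold extIncr
  split_ifs
  · exact measurable_pi_apply _
  · exact measurable_const

/-- `leftMom` is measurable. -/
theorem measurable_leftMom (N : ℕ) : Measurable (leftMom N) := by
  unfold leftMom; split_ifs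
  · exact (measurable_pi_apply _).comp measurable_snd
  · exact measurable_const

/-- `rightMom` is measurable. -/
theorem measurable_rightMom (N : ℕ) : Measurable (rightMom N) := by
  unfold rightMom; split_ifs
  · exact (measurable_pi_apply _).comp measurable_snd
  · exact measurable_const

namespace SchemeData

variable (D : SchemeData N)

/-- The forcing with `M` steps only reads the first `M` increments. -/
theorem forcing_congr (ε σ : ℝ) (M : ℕ) (y : PhaseSpace N) {x x' : ℕ → ℝ × ℝ}
    (h : ∀ j, j < M → x j = x' j) : D.forcing ε σ M y x = D.forcing ε σ M y x' := by
  funext s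
  unfold forcing
  refine Finset.sum_congr rfl fun j hj => ?_
  have hjM := Finset.mem_range.1 hj
  rw [D.state_congr ε σ y j (fun i hi => h i (lt_trans hi hjM)), h j hjM]

/-- The path with `M` steps only reads the first `M` increments. -/
theorem path_congr (ε σ : ℝ) (M : ℕ) (y : PhaseSpace N) {x x' : ℕ → ℝ × ℝ}
    (h : ∀ j, j < M → x j = x' j) : D.path ε σ M y x = D.path ε σ M y x' := by
  unfold path
  rw [D.forcing_congr ε σ M y h]

/-- The damped-to-anti shift on the finite increment space. -/
def shiftFin (M : ℕ) (y : PhaseSpace N) (x : Fin M → ℝ × ℝ) : Fin M → ℝ × ℝ :=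
  fun k => D.shift y (extIncr M x) k

/-- The anti-to-damped shift on the finite increment space. -/
def unshiftFin (M : ℕ) (y : PhaseSpace N) (x : Fin M → ℝ × ℝ) : Fin M → ℝ × ℝ :=
  fun k => D.unshift y (extIncr M x) k

/-- `extIncr ∘ shiftFin` agrees with `shift ∘ extIncr` in the range. -/
theorem extIncr_shiftFin (M : ℕ) (y : PhaseSpace N) (x : Fin M → ℝ × ℝ) :
    ∀ j, j < M → extIncr M (D.shiftFin M y x) j = D.shift y (extIncr M x) j := by
  intro j hj
  rw [extIncr_apply_lt _ hj]
  rfl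

/-- `extIncr ∘ unshiftFin` agrees with `unshift ∘ extIncr` in the range. -/
theorem extIncr_unshiftFin (M : ℕ) (y : PhaseSpace N) (x : Fin M → ℝ × ℝ) :
    ∀ j, j < M → extIncr M (D.unshiftFin M y x) j = D.unshift y (extIncr M x) j := by
  intro j hj
  rw [extIncr_apply_lt _ hj]
  rfl

/-- **The damped path driven by `S x` is the anti-damped path driven by `x`.** -/
theorem path_shiftFin (hL : D.cL ≠ 0) (hR : D.cR ≠ 0) (M : ℕ) (y : PhaseSpace N) (x : Fin M → ℝ × ℝ) :
    D.path 1 1 M y (extIncr M (D.shiftFin M y x)) = D.path (-1) (-1) M y (extIncr M x) := by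
  rw [D.path_congr 1 1 M y (D.extIncr_shiftFin M y x), D.path_damped_shift hL hR]

/-- **The anti-damped path driven by `U x` is the damped path driven by `x`.** -/
theorem path_unshiftFin (hL : D.cL ≠ 0) (hR : D.cR ≠ 0) (M : ℕ) (y : PhaseSpace N) (x : Fin M → ℝ × ℝ) :
    D.path (-1) (-1) M y (extIncr M (D.unshiftFin M y x)) = D.path 1 1 M y (extIncr M x) := by
  rw [D.path_congr (-1) (-1) M y (D.extIncr_unshiftFin M y x)]
  unfold path
  rw [← D.forcing_damped_shift hL hR M y (D.unshift y (extIncr M x)), D.shift_unshift hL hR]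

/-! ### The two shifts preserve Lebesgue measure -/

/-- The predictable part of a shift: `2γh (clamp_R(p_0(z_k))/c_L, clamp_R(p_{N-1}(z_k))/c_R)` along the
states of signs `(ε, σ)`. -/
def shiftPart (ε σ : ℝ) (M : ℕ) (y : PhaseSpace N) (x : Fin M → ℝ × ℝ) (k : Fin M) : ℝ × ℝ :=
  (2 * D.γ * D.h * clampR D.R (leftMom N (D.state ε σ y (extIncr M x) k)) / D.cL,
    2 * D.γ * D.h * clampR D.R (rightMom N (D.state ε σ y (extIncr M x) k)) / D.cR)

/-- `S x = -x + (predictable part along the anti-damped states)`. -/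
theorem shiftFin_eq (M : ℕ) (y : PhaseSpace N) :
    D.shiftFin M y = fun x k => -(x k) + D.shiftPart (-1) (-1) M y x k := by
  funext x k
  simp only [shiftFin, shift, shiftPart, extIncr_apply_fin]
  rfl

/-- `U x = -x + (predictable part along the damped states)`. -/
theorem unshiftFin_eq (M : ℕ) (y : PhaseSpace N) :
    D.unshiftFin M y = fun x k => -(x k) + D.shiftPart 1 1 M y x k := by
  funext x k
  simp only [unshiftFin, unshift, shiftPart, extIncr_apply_fin]
  rfl

variable {D}
variable (D₀ : ConfinedDrift D.Y₀) (hD₀ : D₀.noise = momentumSubspace N)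
include D₀ hD₀

/-- The states along `extIncr` are measurable on the finite increment space. -/
theorem measurable_state_extIncr (ε σ : ℝ) (M : ℕ) (y : PhaseSpace N) (k : ℕ) :
    Measurable fun x : Fin M → ℝ × ℝ => D.state ε σ y (extIncr M x) k :=
  measurable_state D₀ hD₀ (measurable_extIncr_apply M) k

/-- The predictable part is measurable. -/
theorem measurable_shiftPart (ε σ : ℝ) (M : ℕ) (y : PhaseSpace N) : Measurable (D.shiftPart ε σ M y) := by
  refine measurable_pi_lambda _ fun k => ?_
  have hs := measurable_state_extIncr D₀ hD₀ ε σ M y (k : ℕ)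
  refine Measurable.prodMk ?_ ?_
  · exact ((((continuous_clampR D.R).measurable.comp ((measurable_leftMom N).comp hs)).const_mul _).div_const _)
  · exact ((((continuous_clampR D.R).measurable.comp ((measurable_rightMom N).comp hs)).const_mul _).div_const _)

omit D₀ hD₀ in
/-- The predictable part IS predictable: its `k`-th component only reads `x_j`, `j < k`. -/
theorem shiftPart_predictable (ε σ : ℝ) (M : ℕ) (y : PhaseSpace N) (x x' : Fin M → ℝ × ℝ) (k : Fin M)
    (hk : ∀ j : Fin M, j < k → x j = x' j) : D.shiftPart ε σ M y x k = D.shiftPart ε σ M y x' k := by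
  have hstate : D.state ε σ y (extIncr M x) k = D.state ε σ y (extIncr M x') k := by
    refine D.state_congr ε σ y k fun i hi => ?_
    have hiM : i < M := lt_trans hi k.2
    rw [extIncr_apply_lt _ hiM, extIncr_apply_lt _ hiM]
    exact hk ⟨i, hiM⟩ (Fin.mk_lt_of_lt_val hi)
  simp only [shiftPart, hstate]

omit D₀ hD₀ in
/-- Negation preserves Lebesgue measure on `ℝ × ℝ`. -/
theorem measurePreserving_neg_volume : MeasurePreserving (Neg.neg : ℝ × ℝ → ℝ × ℝ) volume volume :=
  Measure.measurePreserving_neg _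

/-- **`S` preserves Lebesgue measure** on the finite increment space. -/
theorem measurePreserving_shiftFin (M : ℕ) (y : PhaseSpace N) :
    MeasurePreserving (D.shiftFin M y) (volume : Measure (Fin M → ℝ × ℝ)) volume := by
  rw [D.shiftFin_eq M y]
  exact measurePreserving_predictableShift Neg.neg measurePreserving_neg_volume M (D.shiftPart (-1) (-1) M y)
    (measurable_shiftPart D₀ hD₀ (-1) (-1) M y) (shiftPart_predictable (-1) (-1) M y)

/-- **`U` preserves Lebesgue measure** on the finite increment space. -/
theorem measurePreserving_unshiftFin (M : ℕ) (y : PhaseSpace N) :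
    MeasurePreserving (D.unshiftFin M y) (volume : Measure (Fin M → ℝ × ℝ)) volume := by
  rw [D.unshiftFin_eq M y]
  exact measurePreserving_predictableShift Neg.neg measurePreserving_neg_volume M (D.shiftPart 1 1 M y)
    (measurable_shiftPart D₀ hD₀ 1 1 M y) (shiftPart_predictable 1 1 M y)

end SchemeData

/-! ### The Gaussian density ratio -/

/-- The ratio of the increment densities at two points is the exponential of the difference of the
squared norms over `2h`. -/
theorem piGaussDensity_ratio (M : ℕ) {h : ℝ} (hh : 0 < h) (x x' : Fin M → ℝ × ℝ) :
    piGaussDensity M h x' / piGaussDensity M h x =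
      ENNReal.ofReal (Real.exp (∑ k, (((x k).1 ^ 2 - (x' k).1 ^ 2) + ((x k).2 ^ 2 - (x' k).2 ^ 2)) / (2 * h))) := by
  have hv : ((h.toNNReal : ℝ≥0) : ℝ) = h := Real.coe_toNNReal _ hh.le
  set c : ℝ := (Real.sqrt (2 * Real.pi * h))⁻¹ with hc
  have hc0 : 0 < c := by rw [hc]; positivity
  -- the real form of the density
  have hreal : ∀ z : Fin M → ℝ × ℝ, piGaussDensity M h z =
      ENNReal.ofReal ((c ^ 2) ^ M * Real.exp (∑ k, -(((z k).1 ^ 2 + (z k).2 ^ 2) / (2 * h)))) := by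
    intro z
    have hterm : ∀ k, gaussDensity2 h (z k) =
        ENNReal.ofReal (c ^ 2 * Real.exp (-(((z k).1 ^ 2 + (z k).2 ^ 2) / (2 * h)))) := by
      intro k
      simp only [gaussDensity2, gaussianPDF, gaussianPDFReal, hv, sub_zero]
      rw [← ENNReal.ofReal_mul (by positivity)]
      congr 1
      rw [show -(((z k).1 ^ 2 + (z k).2 ^ 2) / (2 * h)) = -(z k).1 ^ 2 / (2 * h) + -(z k).2 ^ 2 / (2 * h) by ring,
        Real.exp_add, hc]
      ring
    unfold piGaussDensity
    simp_rw [hterm]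
    rw [← ENNReal.ofReal_prod_of_nonneg fun k _ => by positivity]
    congr 1
    rw [Finset.prod_mul_distrib, Finset.prod_const, Finset.card_univ, Fintype.card_fin, Real.exp_sum]
  rw [hreal x, hreal x', ← ENNReal.ofReal_div_of_pos (by positivity)]
  congr 1
  rw [mul_div_mul_left _ _ (by positivity), ← Real.exp_sub]
  congr 1
  rw [← Finset.sum_sub_distrib]
  refine Finset.sum_congr rfl fun k _ => ?_
  ring

/-! ### The reweighting identities under the Wiener pair -/

section Reweight

variable {D : SchemeData N} (D₀ : ConfinedDrift D.Y₀) (hD₀ : D₀.noise = momentumSubspace N)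
  (hh : 0 < D.h) (M : ℕ) (y : PhaseSpace N)
include D₀ hD₀ hh

omit D₀ hD₀ hh in
/-- The logarithm of the density ratio of a shift with predictable part `a`:
`Σ_k [(2 a_k · x_k - |a_k|²)/(2h)]` coordinatewise. -/
theorem log_ratio_eq (h : ℝ) (a : (Fin M → ℝ × ℝ) → Fin M → ℝ × ℝ) (x : Fin M → ℝ × ℝ) :
    ∑ k, (((x k).1 ^ 2 - (-(x k) + a x k).1 ^ 2) + ((x k).2 ^ 2 - (-(x k) + a x k).2 ^ 2)) / (2 * h) =
      ∑ k, ((2 * (a x k).1 * (x k).1 - (a x k).1 ^ 2) + (2 * (a x k).2 * (x k).2 - (a x k).2 ^ 2)) / (2 * h) := by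
  refine Finset.sum_congr rfl fun k _ => ?_
  simp only [Prod.fst_add, Prod.snd_add, Prod.fst_neg, Prod.snd_neg]
  ring

/-- **The reweighting identity for the shift `S`** (discrete Cameron–Martin, DI-1 form): for every
measurable `Ψ ≥ 0` on the increment space,
`E[Ψ(ξ)] = E[Ψ(S ξ) · exp(Σ_k ((2 a_k·ξ_k - |a_k|²)/(2h)))]`, `a` the predictable part of `S`,
`ξ = pairGridIncr M h` the grid increments of the Brownian pair. -/
theorem lintegral_eq_lintegral_shiftFin_mul {Ψ : (Fin M → ℝ × ℝ) → ℝ≥0∞} (hΨ : Measurable Ψ) :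
    ∫⁻ ω, Ψ (pairGridIncr M D.h ω) ∂wienerPair =
      ∫⁻ ω, Ψ (D.shiftFin M y (pairGridIncr M D.h ω)) *
        ENNReal.ofReal (Real.exp (∑ k,
          ((2 * (D.shiftPart (-1) (-1) M y (pairGridIncr M D.h ω) k).1 * (pairGridIncr M D.h ω k).1 -
              (D.shiftPart (-1) (-1) M y (pairGridIncr M D.h ω) k).1 ^ 2) +
            (2 * (D.shiftPart (-1) (-1) M y (pairGridIncr M D.h ω) k).2 * (pairGridIncr M D.h ω k).2 -
              (D.shiftPart (-1) (-1) M y (pairGridIncr M D.h ω) k).2 ^ 2)) / (2 * D.h))) ∂wienerPair := by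
  have h := lintegral_comp_eq_lintegral_comp_shift_mul (P := wienerPair) (measurable_pairGridIncr M D.h)
    (SchemeData.measurePreserving_shiftFin D₀ hD₀ M y) (measurable_piGaussDensity M D.h)
    (piGaussDensity_pos M hh) (piGaussDensity_ne_top M D.h) (map_pairGridIncr_wienerPair M D.h hh) hΨ
  rw [h]
  refine lintegral_congr fun ω => ?_
  congr 1
  rw [piGaussDensity_ratio M hh]
  congr 2
  conv_lhs => rw [D.shiftFin_eq M y]
  exact log_ratio_eq M D.h (D.shiftPart (-1) (-1) M y) _

/-- **The reweighting identity for the inverse shift `U`** (DI-2 form). -/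
theorem lintegral_eq_lintegral_unshiftFin_mul {Ψ : (Fin M → ℝ × ℝ) → ℝ≥0∞} (hΨ : Measurable Ψ) :
    ∫⁻ ω, Ψ (pairGridIncr M D.h ω) ∂wienerPair =
      ∫⁻ ω, Ψ (D.unshiftFin M y (pairGridIncr M D.h ω)) *
        ENNReal.ofReal (Real.exp (∑ k,
          ((2 * (D.shiftPart 1 1 M y (pairGridIncr M D.h ω) k).1 * (pairGridIncr M D.h ω k).1 -
              (D.shiftPart 1 1 M y (pairGridIncr M D.h ω) k).1 ^ 2) +
            (2 * (D.shiftPart 1 1 M y (pairGridIncr M D.h ω) k).2 * (pairGridIncr M D.h ω k).2 -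
              (D.shiftPart 1 1 M y (pairGridIncr M D.h ω) k).2 ^ 2)) / (2 * D.h))) ∂wienerPair := by
  have h := lintegral_comp_eq_lintegral_comp_shift_mul (P := wienerPair) (measurable_pairGridIncr M D.h)
    (SchemeData.measurePreserving_unshiftFin D₀ hD₀ M y) (measurable_piGaussDensity M D.h)
    (piGaussDensity_pos M hh) (piGaussDensity_ne_top M D.h) (map_pairGridIncr_wienerPair M D.h hh) hΨ
  rw [h]
  refine lintegral_congr fun ω => ?_
  congr 1
  rw [piGaussDensity_ratio M hh]
  congr 2
  conv_lhs => rw [D.unshiftFin_eq M y]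
  exact log_ratio_eq M D.h (D.shiftPart 1 1 M y) _

end Reweight

/-- **The Gaussian density ratio of the grid increments** — `∀`-form registered as a sub-goal of the crux item. -/
theorem piGaussDensity_ratio_eq :
    ∀ (M : ℕ) (h : ℝ), 0 < h → ∀ (x x' : Fin M → ℝ × ℝ), piGaussDensity M h x' / piGaussDensity M h x = ENNReal.ofReal (Real.exp (∑ k, (((x k).1 ^ 2 - (x' k).1 ^ 2) + ((x k).2 ^ 2 - (x' k).2 ^ 2)) / (2 * h))) :=
  fun M _ hh x x' => piGaussDensity_ratio M hh x x'

end Summit.AtomisticToContinuum.FouriersLaw.Theorems.LinearResponseFTUR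

end
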